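import Literature.Analysis.FluidPDE.LaplaceDivFormLocalisation
import Literature.Analysis.FunctionSpaces.MollificationLp
import Mathlib.Topology.MetricSpace.Thickening
import HarnessLib

/-!
# Caccioppoli's inequality for weak solutions of `Δw = div F` on a ball

Analysis/FluidPDE support file (everything proved) on the discharge path of the named fact
`Literature.Analysis.FluidPDE.LaplaceDivFormInteriorHolder` (`NSBoundedSpatialHolder.lean`;
Gilbarg–Trudinger 2001, Thm. 8.24 for the Laplacian). Setting as in
`LaplaceDivFormLocalisation`: `w` has weak derivative `g` on `B = B(x₀, R)`, `w, g ∈ L²(B)`,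
`F ∈ L²(B)`, and `∫_B g(∇φ) = ∫_B ⟨F, ∇φ⟩` for all `φ ∈ C_c^∞(B)`. For a cut-off `η ∈ C_c^∞(B)`:

* `hasWeakFDerivOn_sq_mul`: `η²w` has the whole-space weak gradient `η²g + 2ηw Dη`;
* `sum_integral_mul_weakGrad_eq`: **the weak equation holds for the test function `η²w`**,
  `∑ⱼ ∫_B gⱼ(η²gⱼ + 2ηw∂ⱼη) = ∑ⱼ ∫_B Fⱼ(η²gⱼ + 2ηw∂ⱼη)` — mollify `η²w` along a bump sequence
  (`FunctionSpaces.exists_contDiffBump_seq`): for small radius the mollifications are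
  `C_c^∞(B)` tests (support control through `IsCompact.exists_cthickening_subset_open`), their
  gradients are the mollified weak gradient
  (`FunctionSpaces.HasWeakFDerivOn.fderiv_convolution_apply`) and converge in `L²`
  (`FunctionSpaces.tendsto_eLpNorm_normed_convolution_sub_self`), so both pairings pass to the
  limit (`tendsto_integral_mul_of_tendsto_eLpNorm`, Cauchy–Schwarz);
* `sq_integral_le`: **Caccioppoli's inequality**
  `∫_B η²|∇w|² ≤ 10 ∫_B w²|∇η|² + 4 ∫_B η²|F|²` (Young absorption of the mixed terms).

Also: `‖ℓ‖² = ∑ⱼ ℓ(eⱼ)²` for functionals on `ℝ³` (`sq_norm_dual_eq_sum`). This is the gradient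
control which, with the Sobolev inequality on balls, bounds `‖w‖_{L⁶}` on inner balls by
`‖w‖_{L²(B)} + ‖F‖_{L²(B)}` — the reason the final Hölder estimate depends on `‖w‖₂` and `‖F‖`
only, as printed in Gilbarg–Trudinger (8.68).

## References

* D. Gilbarg, N. S. Trudinger, *Elliptic Partial Differential Equations of Second Order*
  (2001), proof of Thm. 8.17 (test function `η²u`), §8.3. [`GilbargTrudinger2001`]
* M. Giaquinta, *Multiple Integrals in the Calculus of Variations and Nonlinear Elliptic
  Systems* (1983), Ch. III, Prop. 2.1 (Caccioppoli inequality).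
* L. C. Evans, *Partial Differential Equations*, 2nd ed. (2010), §5.3.1 and App. C.4
  (mollification of Sobolev functions). [`Evans2010`]
-/

noncomputable section

open MeasureTheory Set Function Filter Topology TopologicalSpace Metric
open scoped NNReal ENNReal RealInnerProductSpace Convolution

namespace Literature.Analysis.FluidPDE

/-- Local notation for physical space `ℝ³ = EuclideanSpace ℝ (Fin 3)`. -/
local notation "ℝ³" => EuclideanSpace ℝ (Fin 3)

/-- Local notation for the standard basis vectors of `ℝ³`. -/
local notation "𝐞" j => EuclideanSpace.single (j : Fin 3) (1 : ℝ)

namespace Caccioppoli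

open SerrinBoundedHolder LaplaceDivFormLocalisation

variable {x₀ : ℝ³} {R : ℝ} {w : ℝ³ → ℝ} {g : ℝ³ → ℝ³ →L[ℝ] ℝ} {F : ℝ³ → ℝ³} {η : ℝ³ → ℝ}

/-! ### Generic tools -/

/-- A continuous function supported in a compact subset of the open set `U`, smul a function
locally integrable on `U` (any Banach space), is integrable on `U`. [folklore] -/
theorem integrableOn_test_smul' {V : Type*} [NormedAddCommGroup V] [NormedSpace ℝ V]
    {U : Opens ℝ³} {ψ : ℝ³ → ℝ} {G : ℝ³ → V} (hψ : Continuous ψ)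
    (hψs : HasCompactSupport ψ) (hψU : tsupport ψ ⊆ (U : Set ℝ³))
    (hG : LocallyIntegrableOn G (U : Set ℝ³) volume) :
    IntegrableOn (fun x => ψ x • G x) (U : Set ℝ³) volume := by
  have hGK : IntegrableOn G (tsupport ψ) volume := hG.integrableOn_compact_subset hψU hψs
  have h1 : IntegrableOn (fun x => ψ x • G x) (tsupport ψ) volume :=
    IntegrableOn.continuousOn_smul hGK hψ.continuousOn hψs
  refine h1.of_forall_sdiff_eq_zero U.isOpen.measurableSet ?_
  intro x hx
  simp [image_eq_zero_of_notMem_tsupport hx.2]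

/-- From integrability on a set to integrability, for functions vanishing off the set. [folklore] -/
theorem integrable_of_integrableOn_of_eq_zero {V : Type*} [NormedAddCommGroup V] {f : ℝ³ → V}
    {s : Set ℝ³} (hf : IntegrableOn f s volume) (h0 : ∀ x, x ∉ s → f x = 0) :
    Integrable f volume :=
  (integrableOn_iff_integrable_of_support_subset (fun x hx => by
    by_contra h; exact (Function.mem_support.1 hx) (h0 x h))).1 hf

/-- From `L²` on a set to `L²`, for functions vanishing off the set (indicator). [folklore] -/
theorem memLp_of_memLp_restrict {V : Type*} [NormedAddCommGroup V] {f : ℝ³ → V} {s : Set ℝ³}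
    (hs : MeasurableSet s) (hf : MemLp f 2 (volume.restrict s)) (h0 : ∀ x, x ∉ s → f x = 0) :
    MemLp f 2 volume := by
  have h : s.indicator f = f := by
    funext x
    by_cases hx : x ∈ s
    · simp [hx]
    · simp [hx, h0 x hx]
  rw [← h]
  exact (memLp_indicator_iff_restrict hs).2 hf

/-- The square of a test function, as a test function `x ↦ η x ^ 2`. [folklore] -/
theorem isTestFunctionOn_sq {U : Opens ℝ³} (hη : FunctionSpaces.IsTestFunctionOn U η) :
    FunctionSpaces.IsTestFunctionOn U fun x => η x ^ 2 where
  contDiff := hη.contDiff.pow 2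
  hasCompactSupport := by
    have h : HasCompactSupport (η * η) := hη.hasCompactSupport.mul_right
    have e : (fun x => η x ^ 2) = η * η := by
      funext x
      simp [pow_two]
    rw [e]
    exact h
  tsupport_subset := by
    refine (closure_minimal (fun x hx => ?_) (isClosed_tsupport η)).trans hη.tsupport_subset
    have : η x ≠ 0 := fun h => hx (by simp [h])
    exact subset_tsupport _ (Function.mem_support.2 this)

/-- `D(η²)(x) v = 2η(x) Dη(x) v`. [folklore] -/
theorem fderiv_sq_apply (hη : ContDiff ℝ (⊤ : ℕ∞) η) (x v : ℝ³) :
    fderiv ℝ (fun x => η x ^ 2) x v = 2 * η x * fderiv ℝ η x v := by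
  have hd : DifferentiableAt ℝ η x := hη.differentiable (by simp) x
  have : (fun x => η x ^ 2) = fun x => η x * η x := by funext x; ring
  rw [this, fderiv_fun_mul hd hd]
  simp only [add_apply, FunLike.coe_smul, Pi.smul_apply, smul_eq_mul]
  ring

/-! ### The test function `η²w` has a whole-space weak gradient -/

/-- **`η²w ∈ W^{1,1}(ℝ³)` with gradient `η²g + 2ηw Dη`.** If `w` has weak derivative `g` on the
ball `B` and `η ∈ C_c^∞(B)`, then `η²w` (vanishing off `B`) has the whole-space weak derivative
`x ↦ η(x)² g(x) + (2η(x)w(x)) Dη(x)` (test the weak derivative on `B` with `θη²`).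
[folklore] -/
theorem hasWeakFDerivOn_sq_mul
    (hw : FunctionSpaces.HasWeakFDerivOn (⟨ball x₀ R, isOpen_ball⟩ : Opens ℝ³) volume w g)
    (hη : ContDiff ℝ (⊤ : ℕ∞) η) (hηc : HasCompactSupport η) (hηs : tsupport η ⊆ ball x₀ R) :
    FunctionSpaces.HasWeakFDerivOn (⊤ : Opens ℝ³) volume (fun x => η x ^ 2 * w x)
      fun x => (η x ^ 2) • g x + (2 * η x * w x) • fderiv ℝ η x := by
  set U : Opens ℝ³ := ⟨ball x₀ R, isOpen_ball⟩ with hU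
  have hηT : FunctionSpaces.IsTestFunctionOn U η := ⟨hη, hηc, hηs⟩
  have hη2T := isTestFunctionOn_sq hηT
  have hzero : ∀ x, x ∉ tsupport η → η x = 0 := fun x hx => image_eq_zero_of_notMem_tsupport hx
  -- integrability of `η²w` and of the gradient
  have hu : IntegrableOn (fun x => η x ^ 2 * w x) (ball x₀ R) volume :=
    integrableOn_test_mul (U := U) hη2T.contDiff.continuous hη2T.hasCompactSupport
      hη2T.tsupport_subset hw.locallyIntegrableOn
  have hu' : Integrable (fun x => η x ^ 2 * w x) volume :=
    integrable_of_integrableOn_of_eq_zero hu fun x hx => by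
      rw [hzero x fun h => hx (hηs h)]; simp
  have hG1 : IntegrableOn (fun x => (η x ^ 2) • g x) (ball x₀ R) volume :=
    integrableOn_test_smul' (U := U) hη2T.contDiff.continuous hη2T.hasCompactSupport
      hη2T.tsupport_subset hw.locallyIntegrableOn_deriv
  have hG2 : IntegrableOn (fun x => (2 * η x * w x) • fderiv ℝ η x) (ball x₀ R) volume := by
    have hwK : IntegrableOn w (tsupport η) volume :=
      hw.locallyIntegrableOn.integrableOn_compact_subset hηs hηc
    have hc : Continuous fun x => (2 * η x) • fderiv ℝ η x :=
      (continuous_const.mul hη.continuous).smul (hη.continuous_fderiv (by simp))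
    have h1 : IntegrableOn (fun x => w x • ((2 * η x) • fderiv ℝ η x)) (tsupport η) volume :=
      hwK.smul_continuousOn hc.continuousOn hηc
    have h2 : Integrable (fun x => w x • ((2 * η x) • fderiv ℝ η x)) volume :=
      integrable_of_integrableOn_of_eq_zero h1 fun x hx => by simp [hzero x hx]
    refine h2.integrableOn.congr_fun (fun x _ => ?_) measurableSet_ball
    simp only [smul_smul]
    congr 1
    ring
  have hG' : Integrable (fun x => (η x ^ 2) • g x + (2 * η x * w x) • fderiv ℝ η x) volume :=
    integrable_of_integrableOn_of_eq_zero (hG1.add hG2) fun x hx => by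
      rw [hzero x fun h => hx (hηs h)]; simp
  refine ⟨?_, ?_, ?_⟩
  · simpa only [Opens.coe_top] using hu'.locallyIntegrable.locallyIntegrableOn univ
  · simpa only [Opens.coe_top] using hG'.locallyIntegrable.locallyIntegrableOn univ
  · intro θ v hθ
    simp only [Opens.coe_top, Measure.restrict_univ, smul_eq_mul, add_apply, FunLike.coe_smul,
      Pi.smul_apply]
    -- the weak derivative on the ball tested with `θη²`
    have hτ : FunctionSpaces.IsTestFunctionOn U fun x => θ x * η x ^ 2 :=
      isTestFunctionOn_mul_left hθ.contDiff hη2T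
    have key := hw.integral_fderiv_smul_eq _ v hτ
    have key' : ∫ x in ball x₀ R, fderiv ℝ (fun x => θ x * η x ^ 2) x v • w x =
        -∫ x in ball x₀ R, (θ x * η x ^ 2) • g x v := key
    have hpt : ∀ x, fderiv ℝ (fun x => θ x * η x ^ 2) x v =
        η x ^ 2 * fderiv ℝ θ x v + θ x * (2 * η x * fderiv ℝ η x v) := by
      intro x
      rw [fderiv_fun_mul (hθ.contDiff.differentiable (by simp) x)
        (hη2T.contDiff.differentiable (by simp) x)]
      simp only [add_apply, FunLike.coe_smul, Pi.smul_apply, smul_eq_mul, fderiv_sq_apply hη]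
      ring
    simp only [hpt, smul_eq_mul] at key'
    -- integrability of the two pieces on the ball
    have hdθT : FunctionSpaces.IsTestFunctionOn (⊤ : Opens ℝ³) fun x => fderiv ℝ θ x v :=
      ⟨(hθ.contDiff.fderiv_right (m := (⊤ : ℕ∞)) le_rfl).clm_apply contDiff_const,
        hθ.hasCompactSupport.fderiv_apply (𝕜 := ℝ) v, by simp⟩
    have hI1 : IntegrableOn (fun x => η x ^ 2 * fderiv ℝ θ x v * w x) (ball x₀ R) volume := by
      have h := integrableOn_test_mul (U := U)
        (isTestFunctionOn_mul_right hη2T hdθT.contDiff).contDiff.continuous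
        (isTestFunctionOn_mul_right hη2T hdθT.contDiff).hasCompactSupport
        (isTestFunctionOn_mul_right hη2T hdθT.contDiff).tsupport_subset hw.locallyIntegrableOn
      exact h
    have hdη : ContDiff ℝ (⊤ : ℕ∞) fun x => fderiv ℝ η x v :=
      (hη.fderiv_right (m := (⊤ : ℕ∞)) le_rfl).clm_apply contDiff_const
    have hdηT : FunctionSpaces.IsTestFunctionOn U fun x => 2 * η x * fderiv ℝ η x v := by
      have h : FunctionSpaces.IsTestFunctionOn U fun x => (2 : ℝ) * (η x * fderiv ℝ η x v) :=
        isTestFunctionOn_mul_left contDiff_const (isTestFunctionOn_mul_right hηT hdη)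
      convert h using 1
      funext x
      ring
    have hI2 : IntegrableOn (fun x => θ x * (2 * η x * fderiv ℝ η x v) * w x) (ball x₀ R)
        volume := by
      have h := integrableOn_test_mul (U := U)
        (isTestFunctionOn_mul_left hθ.contDiff hdηT).contDiff.continuous
        (isTestFunctionOn_mul_left hθ.contDiff hdηT).hasCompactSupport
        (isTestFunctionOn_mul_left hθ.contDiff hdηT).tsupport_subset hw.locallyIntegrableOn
      exact h
    rw [show (fun x => (η x ^ 2 * fderiv ℝ θ x v + θ x * (2 * η x * fderiv ℝ η x v)) * w x) =
        fun x => η x ^ 2 * fderiv ℝ θ x v * w x + θ x * (2 * η x * fderiv ℝ η x v) * w x from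
      funext fun x => by ring, integral_add hI1 hI2] at key'
    -- whole-space integrals are integrals over the ball
    have e1 : ∫ x, fderiv ℝ θ x v * (η x ^ 2 * w x) =
        ∫ x in ball x₀ R, η x ^ 2 * fderiv ℝ θ x v * w x := by
      rw [← setIntegral_eq_integral_of_forall_compl_eq_zero (s := ball x₀ R) fun x hx => ?_]
      · refine integral_congr_ae (Eventually.of_forall fun x => ?_)
        ring
      · rw [hzero x fun h => hx (hηs h)]; simp
    have e2 : ∫ x, θ x * (η x ^ 2 * g x v + 2 * η x * w x * fderiv ℝ η x v) =
        (∫ x in ball x₀ R, θ x * η x ^ 2 * g x v) +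
          ∫ x in ball x₀ R, θ x * (2 * η x * fderiv ℝ η x v) * w x := by
      have hJ1 : IntegrableOn (fun x => θ x * η x ^ 2 * g x v) (ball x₀ R) volume := by
        have h := integrableOn_test_mul (U := U) hτ.contDiff.continuous hτ.hasCompactSupport
          hτ.tsupport_subset
          ((ContinuousLinearMap.apply ℝ ℝ v).locallyIntegrableOn_comp hw.locallyIntegrableOn_deriv)
        refine h.congr_fun (fun x _ => ?_) measurableSet_ball
        simp
      rw [← integral_add hJ1 hI2,
        ← setIntegral_eq_integral_of_forall_compl_eq_zero (s := ball x₀ R) fun x hx => ?_]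
      · refine integral_congr_ae (Eventually.of_forall fun x => ?_)
        ring
      · rw [hzero x fun h => hx (hηs h)]; simp
    rw [e1, e2]
    linarith [key']

/-! ### Norms in coordinates -/

/-- `‖ℓ‖² = ∑ⱼ ℓ(eⱼ)²` for a functional on `ℝ³` (Riesz isometry). [folklore] -/
theorem sq_norm_dual_eq_sum (ℓ : ℝ³ →L[ℝ] ℝ) : ‖ℓ‖ ^ 2 = ∑ j, (ℓ (𝐞 j)) ^ 2 := by
  set v : ℝ³ := (InnerProductSpace.toDual ℝ ℝ³).symm ℓ with hv
  have h1 : ‖ℓ‖ = ‖v‖ := by rw [hv, LinearIsometryEquiv.norm_map]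
  have h2 : ∀ j : Fin 3, v j = ℓ (𝐞 j) := fun j => by
    rw [coord_eq_inner_single, hv, InnerProductSpace.toDual_symm_apply]
  rw [h1, EuclideanSpace.norm_sq_eq]
  exact Finset.sum_congr rfl fun j _ => by rw [Real.norm_eq_abs, sq_abs, h2]

/-! ### `L²` pairings pass to the limit -/

/-- If `aₙ → a` in `L²(μ)` and `v ∈ L²(μ)` then `∫ v aₙ → ∫ v a` (Cauchy–Schwarz). [folklore] -/
theorem tendsto_integral_mul_of_tendsto_eLpNorm {μ : Measure ℝ³} {v : ℝ³ → ℝ} {a : ℕ → ℝ³ → ℝ}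
    {b : ℝ³ → ℝ} (hv : MemLp v 2 μ) (ha : ∀ n, MemLp (a n) 2 μ) (hb : MemLp b 2 μ)
    (hlim : Tendsto (fun n => eLpNorm (a n - b) 2 μ) atTop (𝓝 0)) :
    Tendsto (fun n => ∫ x, v x * a n x ∂μ) atTop (𝓝 (∫ x, v x * b x ∂μ)) := by
  have h22 : (2 : ℝ).HolderConjugate 2 := by rw [Real.holderConjugate_iff]; norm_num
  have hvi : ∀ n, Integrable (fun x => v x * a n x) μ := fun n => hv.integrable_mul (ha n)
  have hvb : Integrable (fun x => v x * b x) μ := hv.integrable_mul hb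
  have hNv : (∫ x, ‖v x‖ ^ (2 : ℝ) ∂μ) ^ (1 / (2 : ℝ)) = (eLpNorm v 2 μ).toReal := by
    rw [hv.eLpNorm_eq_integral_rpow_norm two_ne_zero ENNReal.ofNat_ne_top,
      ENNReal.toReal_ofReal (by positivity)]
    norm_num
  have hbound : ∀ n, |(∫ x, v x * a n x ∂μ) - ∫ x, v x * b x ∂μ| ≤
      (eLpNorm v 2 μ).toReal * (eLpNorm (a n - b) 2 μ).toReal := by
    intro n
    have hsub : MemLp (a n - b) 2 μ := (ha n).sub hb
    rw [← integral_sub (hvi n) hvb]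
    have e : ∀ x, v x * a n x - v x * b x = v x * (a n - b) x := fun x => by
      simp only [Pi.sub_apply]; ring
    simp_rw [e]
    have hv' : MemLp v (ENNReal.ofReal 2) μ := by rw [ENNReal.ofReal_ofNat]; exact hv
    have hsub' : MemLp (a n - b) (ENNReal.ofReal 2) μ := by rw [ENNReal.ofReal_ofNat]; exact hsub
    have h := integral_mul_norm_le_Lp_mul_Lq h22 hv' hsub'
    have hN2 : (∫ x, ‖(a n - b) x‖ ^ (2 : ℝ) ∂μ) ^ (1 / (2 : ℝ)) =
        (eLpNorm (a n - b) 2 μ).toReal := by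
      rw [hsub.eLpNorm_eq_integral_rpow_norm two_ne_zero ENNReal.ofNat_ne_top,
        ENNReal.toReal_ofReal (by positivity)]
      norm_num
    rw [hNv, hN2] at h
    calc |∫ x, v x * (a n - b) x ∂μ| ≤ ∫ x, |v x * (a n - b) x| ∂μ := abs_integral_le_integral_abs
      _ = ∫ x, ‖v x‖ * ‖(a n - b) x‖ ∂μ := by
          congr 1; funext x; rw [abs_mul, Real.norm_eq_abs, Real.norm_eq_abs]
      _ ≤ _ := h
  have hto0 : Tendsto (fun n => (eLpNorm v 2 μ).toReal * (eLpNorm (a n - b) 2 μ).toReal) atTop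
      (𝓝 0) := by
    have h := (ENNReal.tendsto_toReal ENNReal.zero_ne_top).comp hlim
    rw [ENNReal.toReal_zero] at h
    simpa using h.const_mul ((eLpNorm v 2 μ).toReal)
  rw [tendsto_iff_norm_sub_tendsto_zero]
  refine squeeze_zero' (Eventually.of_forall fun n => norm_nonneg _)
    (Eventually.of_forall fun n => ?_) hto0
  rw [Real.norm_eq_abs]
  exact hbound n

/-! ### The identity obtained by testing with `η²w` -/

/-- Bounded measurable multiples of `L²` functions are `L²`. [folklore] -/
theorem memLp_two_mul_of_bound {μ : Measure ℝ³} {c f : ℝ³ → ℝ} {C : ℝ} (hc : Continuous c)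
    (hC : ∀ x, ‖c x‖ ≤ C) (hf : MemLp f 2 μ) : MemLp (fun x => c x * f x) 2 μ :=
  MemLp.of_le_mul hf (hc.aestronglyMeasurable.mul hf.1)
    (Eventually.of_forall fun x => by
      rw [norm_mul]; exact mul_le_mul_of_nonneg_right (hC x) (norm_nonneg _))

/-- **Testing the equation with `η²w`.** For a `W^{1,2}(B)` weak solution of `Δw = div F`
(C_c^∞-tests) with `F ∈ L²(B)` and `η ∈ C_c^∞(B)`:
`∑ⱼ ∫_B gⱼ (η²gⱼ + 2ηw∂ⱼη) = ∑ⱼ ∫_B Fⱼ (η²gⱼ + 2ηw∂ⱼη)`, i.e. the weak equation holds for the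
test function `η²w ∈ W^{1,2}_0(B)` (mollify `η²w`, whose whole-space weak gradient is
`η²g + 2ηwDη` (`hasWeakFDerivOn_sq_mul`); the mollifications are admissible tests for small
radius, their gradients are the mollified gradient
(`FunctionSpaces.HasWeakFDerivOn.fderiv_convolution_apply`) and converge in `L²`
(`FunctionSpaces.tendsto_eLpNorm_normed_convolution_sub_self`); pass to the limit in both
pairings). [folklore] -/
theorem sum_integral_mul_weakGrad_eq
    (hw : FunctionSpaces.HasWeakFDerivOn (⟨ball x₀ R, isOpen_ball⟩ : Opens ℝ³) volume w g)
    (hw2 : MemLp w 2 (volume.restrict (ball x₀ R)))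
    (hg2 : MemLp g 2 (volume.restrict (ball x₀ R)))
    (hF2 : MemLp F 2 (volume.restrict (ball x₀ R)))
    (heq : ∀ φ : ℝ³ → ℝ, FunctionSpaces.IsTestFunctionOn (⟨ball x₀ R, isOpen_ball⟩ : Opens ℝ³) φ →
      ∫ x in ball x₀ R, g x (gradient φ x) = ∫ x in ball x₀ R, ⟪F x, gradient φ x⟫)
    (hη : ContDiff ℝ (⊤ : ℕ∞) η) (hηc : HasCompactSupport η) (hηs : tsupport η ⊆ ball x₀ R) :
    ∑ j, ∫ x in ball x₀ R, g x (𝐞 j) *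
        (η x ^ 2 * g x (𝐞 j) + 2 * η x * w x * fderiv ℝ η x (𝐞 j)) =
      ∑ j, ∫ x in ball x₀ R, F x j *
        (η x ^ 2 * g x (𝐞 j) + 2 * η x * w x * fderiv ℝ η x (𝐞 j)) := by
  set U : Opens ℝ³ := ⟨ball x₀ R, isOpen_ball⟩ with hU
  set μB : Measure ℝ³ := volume.restrict (ball x₀ R) with hμB
  have hηT : FunctionSpaces.IsTestFunctionOn U η := ⟨hη, hηc, hηs⟩
  have hzero : ∀ x, x ∉ tsupport η → η x = 0 := fun x hx => image_eq_zero_of_notMem_tsupport hx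
  -- the test function `u = η²w` and its whole-space weak gradient
  set u : ℝ³ → ℝ := fun x => η x ^ 2 * w x with hu_def
  set Gu : ℝ³ → ℝ³ →L[ℝ] ℝ := fun x => (η x ^ 2) • g x + (2 * η x * w x) • fderiv ℝ η x
    with hGu_def
  have hu := hasWeakFDerivOn_sq_mul hw hη hηc hηs
  set Guj : Fin 3 → ℝ³ → ℝ := fun j x => Gu x (𝐞 j) with hGuj_def
  have hGuj : ∀ j x, Guj j x = η x ^ 2 * g x (𝐞 j) + 2 * η x * w x * fderiv ℝ η x (𝐞 j) := by
    intro j x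
    simp only [hGuj_def, hGu_def, add_apply, FunLike.coe_smul, Pi.smul_apply, smul_eq_mul]
  -- bounds for `η` and `Dη`
  obtain ⟨C₀, hC₀⟩ := hη.continuous.bounded_above_of_compact_support hηc
  obtain ⟨C₁, hC₁⟩ := (hη.continuous_fderiv (by simp)).bounded_above_of_compact_support
    (hηc.fderiv (𝕜 := ℝ))
  have hC₀' : 0 ≤ C₀ := (norm_nonneg _).trans (hC₀ 0)
  have hC₁' : 0 ≤ C₁ := (norm_nonneg _).trans (hC₁ 0)
  -- the components are `L²` on the whole space
  have hgj : ∀ j, MemLp (fun x => g x (𝐞 j)) 2 μB := fun j =>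
    (ContinuousLinearMap.apply ℝ ℝ (𝐞 j)).comp_memLp' hg2
  have hFj : ∀ j, MemLp (fun x => F x j) 2 μB := fun j =>
    (EuclideanSpace.proj j : ℝ³ →L[ℝ] ℝ).comp_memLp' hF2
  have hGuj2 : ∀ j, MemLp (Guj j) 2 volume := by
    intro j
    have h1 : MemLp (fun x => η x ^ 2 * g x (𝐞 j)) 2 μB :=
      memLp_two_mul_of_bound (hη.continuous.pow 2) (C := C₀ ^ 2)
        (fun x => by rw [norm_pow]; exact pow_le_pow_left₀ (norm_nonneg _) (hC₀ x) 2) (hgj j)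
    have h2 : MemLp (fun x => (2 * η x * fderiv ℝ η x (𝐞 j)) * w x) 2 μB := by
      refine memLp_two_mul_of_bound ((continuous_const.mul hη.continuous).mul
        ((hη.continuous_fderiv (by simp)).clm_apply continuous_const)) (C := 2 * C₀ * C₁)
        (fun x => ?_) hw2
      rw [norm_mul, norm_mul, Real.norm_ofNat]
      have h3 : ‖fderiv ℝ η x (𝐞 j)‖ ≤ C₁ := by
        refine (ContinuousLinearMap.le_opNorm _ _).trans ?_
        have : ‖(𝐞 j : ℝ³)‖ = 1 := by simp
        rw [this, mul_one]
        exact hC₁ x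
      gcongr
      exact hC₀ x
    have h12 : MemLp (fun x => η x ^ 2 * g x (𝐞 j) + (2 * η x * fderiv ℝ η x (𝐞 j)) * w x) 2 μB :=
      h1.add h2
    have h12' : MemLp (Guj j) 2 μB := by
      refine h12.ae_eq (Eventually.of_forall fun x => ?_)
      rw [hGuj]
      ring
    refine memLp_of_memLp_restrict measurableSet_ball h12' fun x hx => ?_
    have hx' : x ∉ tsupport η := fun h => hx (hηs h)
    rw [hGuj, hzero x hx', fderiv_of_notMem_tsupport ℝ hx']
    simp
  -- a mollifier sequence and the mollified tests
  obtain ⟨φ, hφ0, hφ2⟩ := FunctionSpaces.exists_contDiffBump_seq (E := ℝ³)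
  set ψ : ℕ → ℝ³ → ℝ := fun n =>
    (φ n).normed volume ⋆[ContinuousLinearMap.lsmul ℝ ℝ, volume] u with hψ_def
  have hρT : ∀ n, FunctionSpaces.IsTestFunctionOn (⊤ : Opens ℝ³) ((φ n).normed volume) :=
    fun n => FunctionSpaces.isTestFunctionOn_normed (φ n)
  have hψs : ∀ n, ContDiff ℝ (⊤ : ℕ∞) (ψ n) := fun n => hu.contDiff_convolution (hρT n)
  have huc : HasCompactSupport u :=
    HasCompactSupport.intro hηc fun x hx => by simp [hu_def, hzero x hx]
  have hψc : ∀ n, HasCompactSupport (ψ n) := fun n =>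
    (φ n).hasCompactSupport_normed.convolution _ huc
  -- support control: small radii keep the mollified tests inside the ball
  obtain ⟨δ, hδ, hδB⟩ := hηc.isCompact.exists_cthickening_subset_open isOpen_ball hηs
  have hev : ∀ᶠ n in atTop, (φ n).rOut ≤ δ :=
    (hφ0.eventually (Iic_mem_nhds hδ)).mono fun n hn => hn
  have hψsupp : ∀ᶠ n in atTop, tsupport (ψ n) ⊆ ball x₀ R := by
    filter_upwards [hev] with n hn
    have h1 : support (ψ n) ⊆ cthickening (φ n).rOut (tsupport η) := by
      refine (support_convolution_subset _).trans ?_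
      intro z hz
      obtain ⟨y, hy, k, hk, rfl⟩ := hz
      rw [(φ n).support_normed_eq, mem_ball_zero_iff] at hy
      have hk' : k ∈ tsupport η := by
        by_contra h
        exact (Function.mem_support.1 hk) (by simp [hu_def, hzero k h])
      refine Metric.mem_cthickening_of_dist_le (y + k) k _ _ hk' ?_
      rw [dist_eq_norm, add_sub_cancel_right]
      exact hy.le
    calc tsupport (ψ n) = closure (support (ψ n)) := rfl
      _ ⊆ cthickening (φ n).rOut (tsupport η) := closure_minimal h1 isClosed_cthickening
      _ ⊆ cthickening δ (tsupport η) := cthickening_mono hn _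
      _ ⊆ ball x₀ R := hδB
  have hψT : ∀ᶠ n in atTop, FunctionSpaces.IsTestFunctionOn U (ψ n) :=
    hψsupp.mono fun n hn => ⟨hψs n, hψc n, hn⟩
  -- gradients of the mollified tests
  have hdψ : ∀ n x (j : Fin 3), fderiv ℝ (ψ n) x (𝐞 j) =
      ((φ n).normed volume ⋆[ContinuousLinearMap.lsmul ℝ ℝ, volume] Guj j) x :=
    fun n x j => hu.fderiv_convolution_apply (hρT n) x (𝐞 j)
  -- the equation for the mollified tests, in coordinates
  have hEq : ∀ᶠ n in atTop,
      ∑ j, ∫ x in ball x₀ R, g x (𝐞 j) *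
          ((φ n).normed volume ⋆[ContinuousLinearMap.lsmul ℝ ℝ, volume] Guj j) x =
        ∑ j, ∫ x in ball x₀ R, F x j *
          ((φ n).normed volume ⋆[ContinuousLinearMap.lsmul ℝ ℝ, volume] Guj j) x := by
    filter_upwards [hψT] with n hn
    have h := heq (ψ n) hn
    simp_rw [dual_apply_gradient, inner_gradient_eq_sum] at h
    have hdT : ∀ j : Fin 3,
        FunctionSpaces.IsTestFunctionOn U fun x => fderiv ℝ (ψ n) x (𝐞 j) := fun j =>
      isTestFunctionOn_fderiv_apply hn (𝐞 j)
    have hIg : ∀ j : Fin 3, IntegrableOn (fun x => fderiv ℝ (ψ n) x (𝐞 j) * g x (𝐞 j))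
        (ball x₀ R) volume := fun j =>
      integrableOn_test_mul (U := U) (hdT j).contDiff.continuous (hdT j).hasCompactSupport
        (hdT j).tsupport_subset
        ((ContinuousLinearMap.apply ℝ ℝ (𝐞 j)).locallyIntegrableOn_comp
          hw.locallyIntegrableOn_deriv)
    have hF' : LocallyIntegrableOn F (ball x₀ R) volume :=
      locallyIntegrableOn_of_locallyIntegrable_restrict (hF2.locallyIntegrable (by norm_num))
    have hIF : ∀ j : Fin 3, IntegrableOn (fun x => F x j * fderiv ℝ (ψ n) x (𝐞 j))
        (ball x₀ R) volume := fun j => by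
      have h := integrableOn_test_mul (U := U) (hdT j).contDiff.continuous
        (hdT j).hasCompactSupport (hdT j).tsupport_subset
        ((EuclideanSpace.proj j : ℝ³ →L[ℝ] ℝ).locallyIntegrableOn_comp hF')
      exact h.congr_fun (fun x _ => mul_comm _ _) measurableSet_ball
    rw [integral_finsetSum _ fun j _ => hIg j, integral_finsetSum _ fun j _ => hIF j] at h
    have hl : ∀ j, ∫ x in ball x₀ R, g x (𝐞 j) *
        ((φ n).normed volume ⋆[ContinuousLinearMap.lsmul ℝ ℝ, volume] Guj j) x =
        ∫ x in ball x₀ R, fderiv ℝ (ψ n) x (𝐞 j) * g x (𝐞 j) := fun j =>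
      integral_congr_ae (Eventually.of_forall fun x => by simp only [hdψ]; ring)
    have hr : ∀ j, ∫ x in ball x₀ R, F x j *
        ((φ n).normed volume ⋆[ContinuousLinearMap.lsmul ℝ ℝ, volume] Guj j) x =
        ∫ x in ball x₀ R, F x j * fderiv ℝ (ψ n) x (𝐞 j) := fun j =>
      integral_congr_ae (Eventually.of_forall fun x => by simp only [hdψ])
    rw [Finset.sum_congr rfl fun j _ => hl j, Finset.sum_congr rfl fun j _ => hr j]
    exact h
  -- limits of both sides
  have hconv : ∀ j n, MemLp ((φ n).normed volume ⋆[ContinuousLinearMap.lsmul ℝ ℝ, volume] Guj j)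
      2 μB := fun j n =>
    (FunctionSpaces.memLp_normed_convolution (φ n) (hGuj2 j) one_le_two).restrict _
  have hGujB : ∀ j, MemLp (Guj j) 2 μB := fun j => (hGuj2 j).restrict _
  have hlim : ∀ j, Tendsto (fun n => eLpNorm
      ((φ n).normed volume ⋆[ContinuousLinearMap.lsmul ℝ ℝ, volume] Guj j - Guj j) 2 μB)
      atTop (𝓝 0) := by
    intro j
    have h := FunctionSpaces.tendsto_eLpNorm_normed_convolution_sub_self (μ := volume) hφ0
      (p := 2) one_le_two ENNReal.ofNat_ne_top (hGuj2 j)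
    refine tendsto_of_tendsto_of_tendsto_of_le_of_le tendsto_const_nhds h (fun n => zero_le)
      fun n => ?_
    exact eLpNorm_mono_measure _ Measure.restrict_le_self
  have hTg : ∀ j, Tendsto (fun n => ∫ x in ball x₀ R, g x (𝐞 j) *
      ((φ n).normed volume ⋆[ContinuousLinearMap.lsmul ℝ ℝ, volume] Guj j) x) atTop
      (𝓝 (∫ x in ball x₀ R, g x (𝐞 j) * Guj j x)) := fun j =>
    tendsto_integral_mul_of_tendsto_eLpNorm (μ := μB) (hgj j) (hconv j) (hGujB j) (hlim j)
  have hTF : ∀ j, Tendsto (fun n => ∫ x in ball x₀ R, F x j *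
      ((φ n).normed volume ⋆[ContinuousLinearMap.lsmul ℝ ℝ, volume] Guj j) x) atTop
      (𝓝 (∫ x in ball x₀ R, F x j * Guj j x)) := fun j =>
    tendsto_integral_mul_of_tendsto_eLpNorm (μ := μB) (hFj j) (hconv j) (hGujB j) (hlim j)
  have hT1 := tendsto_finsetSum Finset.univ fun j (_ : j ∈ Finset.univ) => hTg j
  have hT2 := tendsto_finsetSum Finset.univ fun j (_ : j ∈ Finset.univ) => hTF j
  have key := tendsto_nhds_unique_of_eventuallyEq hT1 hT2 hEq
  simp only [hGuj] at key
  exact key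

/-! ### Caccioppoli's inequality -/

/-- **Caccioppoli's inequality** (Giaquinta 1983, Ch. III, Prop. 2.1; Gilbarg–Trudinger, proof
of Thm. 8.17 with the test function `η²u`): for a `W^{1,2}(B)` weak solution of `Δw = div F`
(C_c^∞-tests) on the ball `B`, `F ∈ L²(B)`, and a cut-off `η ∈ C_c^∞(B)`,

  `∫_B η² |∇w|² ≤ 10 ∫_B w² |∇η|² + 4 ∫_B η² |F|²`.

Proof: the weak equation tested with `η²w` (`sum_integral_mul_weakGrad_eq`) reads
`∑ⱼ ∫ (ηgⱼ)² + 2(ηgⱼ)(w∂ⱼη) = ∑ⱼ ∫ (ηFⱼ)(ηgⱼ) + 2(ηFⱼ)(w∂ⱼη)`; bound the three mixed products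
by `¼(ηgⱼ)² + (ηFⱼ)²`, `(ηFⱼ)² + (w∂ⱼη)²`, `¼(ηgⱼ)² + 4(w∂ⱼη)²` and absorb. [cite: GilbargTrudinger2001, proof of Thm. 8.17 / (8.38) (Caccioppoli-type estimate with the test function η²u), here for L = Δ] -/
theorem sq_integral_le
    (hw : FunctionSpaces.HasWeakFDerivOn (⟨ball x₀ R, isOpen_ball⟩ : Opens ℝ³) volume w g)
    (hw2 : MemLp w 2 (volume.restrict (ball x₀ R)))
    (hg2 : MemLp g 2 (volume.restrict (ball x₀ R)))
    (hF2 : MemLp F 2 (volume.restrict (ball x₀ R)))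
    (heq : ∀ φ : ℝ³ → ℝ, FunctionSpaces.IsTestFunctionOn (⟨ball x₀ R, isOpen_ball⟩ : Opens ℝ³) φ →
      ∫ x in ball x₀ R, g x (gradient φ x) = ∫ x in ball x₀ R, ⟪F x, gradient φ x⟫)
    (hη : ContDiff ℝ (⊤ : ℕ∞) η) (hηc : HasCompactSupport η) (hηs : tsupport η ⊆ ball x₀ R) :
    ∫ x in ball x₀ R, η x ^ 2 * ‖g x‖ ^ 2 ≤
      10 * (∫ x in ball x₀ R, w x ^ 2 * ‖fderiv ℝ η x‖ ^ 2) +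
        4 * ∫ x in ball x₀ R, η x ^ 2 * ‖F x‖ ^ 2 := by
  have I := sum_integral_mul_weakGrad_eq hw hw2 hg2 hF2 heq hη hηc hηs
  -- bounds for `η`, `Dη`
  obtain ⟨C₀, hC₀⟩ := hη.continuous.bounded_above_of_compact_support hηc
  obtain ⟨C₁, hC₁⟩ := (hη.continuous_fderiv (by simp)).bounded_above_of_compact_support
    (hηc.fderiv (𝕜 := ℝ))
  have hdηb : ∀ x (j : Fin 3), ‖fderiv ℝ η x (𝐞 j)‖ ≤ C₁ := fun x j => by
    refine (ContinuousLinearMap.le_opNorm _ _).trans ?_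
    have : ‖(𝐞 j : ℝ³)‖ = 1 := by simp
    rw [this, mul_one]
    exact hC₁ x
  -- the `L²(B)` functions `A = ηgⱼ`, `Bf = ηFⱼ`, `Cw = w∂ⱼη`
  set A : Fin 3 → ℝ³ → ℝ := fun j x => η x * g x (𝐞 j) with hA
  set Bf : Fin 3 → ℝ³ → ℝ := fun j x => η x * F x j with hBf
  set Cw : Fin 3 → ℝ³ → ℝ := fun j x => fderiv ℝ η x (𝐞 j) * w x with hCw
  have hgj : ∀ j, MemLp (fun x => g x (𝐞 j)) 2 (volume.restrict (ball x₀ R)) := fun j =>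
    (ContinuousLinearMap.apply ℝ ℝ (𝐞 j)).comp_memLp' hg2
  have hFj : ∀ j, MemLp (fun x => F x j) 2 (volume.restrict (ball x₀ R)) := fun j =>
    (EuclideanSpace.proj j : ℝ³ →L[ℝ] ℝ).comp_memLp' hF2
  have hA2 : ∀ j, MemLp (A j) 2 (volume.restrict (ball x₀ R)) := fun j =>
    memLp_two_mul_of_bound hη.continuous hC₀ (hgj j)
  have hB2 : ∀ j, MemLp (Bf j) 2 (volume.restrict (ball x₀ R)) := fun j =>
    memLp_two_mul_of_bound hη.continuous hC₀ (hFj j)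
  have hC2 : ∀ j, MemLp (Cw j) 2 (volume.restrict (ball x₀ R)) := fun j =>
    memLp_two_mul_of_bound ((hη.continuous_fderiv (by simp)).clm_apply continuous_const)
      (fun x => hdηb x j) hw2
  -- integrable products (on the ball)
  have iAA : ∀ j, IntegrableOn (fun x => A j x * A j x) (ball x₀ R) volume := fun j =>
    (hA2 j).integrable_mul (hA2 j)
  have iAC : ∀ j, IntegrableOn (fun x => A j x * Cw j x) (ball x₀ R) volume := fun j =>
    (hA2 j).integrable_mul (hC2 j)
  have iBA : ∀ j, IntegrableOn (fun x => Bf j x * A j x) (ball x₀ R) volume := fun j =>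
    (hB2 j).integrable_mul (hA2 j)
  have iBC : ∀ j, IntegrableOn (fun x => Bf j x * Cw j x) (ball x₀ R) volume := fun j =>
    (hB2 j).integrable_mul (hC2 j)
  have iBB : ∀ j, IntegrableOn (fun x => Bf j x * Bf j x) (ball x₀ R) volume := fun j =>
    (hB2 j).integrable_mul (hB2 j)
  have iCC : ∀ j, IntegrableOn (fun x => Cw j x * Cw j x) (ball x₀ R) volume := fun j =>
    (hC2 j).integrable_mul (hC2 j)
  -- rewrite the tested identity with `A`, `Bf`, `Cw`
  have i1 : ∀ j, IntegrableOn (fun x => 2 * (A j x * Cw j x)) (ball x₀ R) volume := fun j =>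
    (iAC j).const_mul 2
  have i2 : ∀ j, IntegrableOn (fun x => 2 * (Bf j x * Cw j x)) (ball x₀ R) volume := fun j =>
    (iBC j).const_mul 2
  have IL : ∀ j, ∫ x in ball x₀ R, g x (𝐞 j) *
      (η x ^ 2 * g x (𝐞 j) + 2 * η x * w x * fderiv ℝ η x (𝐞 j)) =
      (∫ x in ball x₀ R, A j x * A j x) + ∫ x in ball x₀ R, 2 * (A j x * Cw j x) := by
    intro j
    rw [← integral_add (iAA j) (i1 j)]
    refine integral_congr_ae (Eventually.of_forall fun x => ?_)
    simp only [hA, hCw]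
    ring
  have IR : ∀ j, ∫ x in ball x₀ R, F x j *
      (η x ^ 2 * g x (𝐞 j) + 2 * η x * w x * fderiv ℝ η x (𝐞 j)) =
      (∫ x in ball x₀ R, Bf j x * A j x) + ∫ x in ball x₀ R, 2 * (Bf j x * Cw j x) := by
    intro j
    rw [← integral_add (iBA j) (i2 j)]
    refine integral_congr_ae (Eventually.of_forall fun x => ?_)
    simp only [hA, hBf, hCw]
    ring
  rw [Finset.sum_congr rfl fun j _ => IL j, Finset.sum_congr rfl fun j _ => IR j] at I
  -- the Young-type absorption, integrated
  have step : ∀ j, (∫ x in ball x₀ R, Bf j x * A j x) + (∫ x in ball x₀ R, 2 * (Bf j x * Cw j x))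
      - (∫ x in ball x₀ R, 2 * (A j x * Cw j x)) ≤
      (∫ x in ball x₀ R, (1 / 2) * (A j x * A j x)) + (∫ x in ball x₀ R, 2 * (Bf j x * Bf j x)) +
        ∫ x in ball x₀ R, 5 * (Cw j x * Cw j x) := by
    intro j
    have j1 : IntegrableOn (fun x => Bf j x * A j x + 2 * (Bf j x * Cw j x)) (ball x₀ R) volume :=
      (iBA j).add (i2 j)
    have j2 : IntegrableOn (fun x => Bf j x * A j x + 2 * (Bf j x * Cw j x) - 2 * (A j x * Cw j x))
        (ball x₀ R) volume := j1.sub (i1 j)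
    have j3 : IntegrableOn (fun x => (1 / 2) * (A j x * A j x)) (ball x₀ R) volume :=
      (iAA j).const_mul _
    have j4 : IntegrableOn (fun x => 2 * (Bf j x * Bf j x)) (ball x₀ R) volume :=
      (iBB j).const_mul _
    have j5 : IntegrableOn (fun x => 5 * (Cw j x * Cw j x)) (ball x₀ R) volume :=
      (iCC j).const_mul _
    have j6 : IntegrableOn (fun x => (1 / 2) * (A j x * A j x) + 2 * (Bf j x * Bf j x)) (ball x₀ R)
        volume := j3.add j4
    have j7 : IntegrableOn (fun x => (1 / 2) * (A j x * A j x) + 2 * (Bf j x * Bf j x) +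
        5 * (Cw j x * Cw j x)) (ball x₀ R) volume := j6.add j5
    have hle : ∫ x in ball x₀ R, (Bf j x * A j x + 2 * (Bf j x * Cw j x) - 2 * (A j x * Cw j x)) ≤
        ∫ x in ball x₀ R, ((1 / 2) * (A j x * A j x) + 2 * (Bf j x * Bf j x) +
          5 * (Cw j x * Cw j x)) := by
      refine integral_mono j2 j7 fun x => ?_
      nlinarith [sq_nonneg (A j x / 2 - Bf j x), sq_nonneg (Bf j x - Cw j x),
        sq_nonneg (A j x / 2 + 2 * Cw j x)]
    rw [integral_sub j1 (i1 j), integral_add (iBA j) (i2 j), integral_add j6 j5,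
      integral_add j3 j4] at hle
    exact hle
  -- absorb
  have hsum : ∑ j, ∫ x in ball x₀ R, A j x * A j x ≤
      4 * (∑ j, ∫ x in ball x₀ R, Bf j x * Bf j x) +
        10 * ∑ j, ∫ x in ball x₀ R, Cw j x * Cw j x := by
    have c1 : ∀ j, ∫ x in ball x₀ R, (1 / 2) * (A j x * A j x) =
        (1 / 2) * ∫ x in ball x₀ R, A j x * A j x := fun j => integral_const_mul _ _
    have c2 : ∀ j, ∫ x in ball x₀ R, 2 * (Bf j x * Bf j x) =
        2 * ∫ x in ball x₀ R, Bf j x * Bf j x := fun j => integral_const_mul _ _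
    have c3 : ∀ j, ∫ x in ball x₀ R, 5 * (Cw j x * Cw j x) =
        5 * ∫ x in ball x₀ R, Cw j x * Cw j x := fun j => integral_const_mul _ _
    have step' := fun j => (step j)
    simp only [c1, c2, c3] at step'
    simp only [Fin.sum_univ_three] at I ⊢
    linarith [step' 0, step' 1, step' 2]
  -- identify the three sums
  have e1 : ∫ x in ball x₀ R, η x ^ 2 * ‖g x‖ ^ 2 = ∑ j, ∫ x in ball x₀ R, A j x * A j x := by
    rw [← integral_finsetSum _ fun j _ => iAA j]
    refine integral_congr_ae (Eventually.of_forall fun x => ?_)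
    simp only [hA, sq_norm_dual_eq_sum, Finset.mul_sum]
    exact Finset.sum_congr rfl fun j _ => by ring
  have e2 : ∫ x in ball x₀ R, η x ^ 2 * ‖F x‖ ^ 2 = ∑ j, ∫ x in ball x₀ R, Bf j x * Bf j x := by
    rw [← integral_finsetSum _ fun j _ => iBB j]
    refine integral_congr_ae (Eventually.of_forall fun x => ?_)
    simp only [hBf, EuclideanSpace.real_norm_sq_eq, Finset.mul_sum]
    exact Finset.sum_congr rfl fun j _ => by ring
  have e3 : ∫ x in ball x₀ R, w x ^ 2 * ‖fderiv ℝ η x‖ ^ 2 =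
      ∑ j, ∫ x in ball x₀ R, Cw j x * Cw j x := by
    rw [← integral_finsetSum _ fun j _ => iCC j]
    refine integral_congr_ae (Eventually.of_forall fun x => ?_)
    simp only [hCw, sq_norm_dual_eq_sum, Finset.mul_sum]
    exact Finset.sum_congr rfl fun j _ => by ring
  rw [e1, e2, e3]
  linarith

end Caccioppoli

end Literature.Analysis.FluidPDE
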